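import Literature.NumberTheory.LFunctions.LandauGonekRightLine
import HarnessLib

/-!
# Landau's formula `∑_{|γ| ≤ T} x^ρ`: the Dirichlet-series side, sharp in the resonance term

Topic: `Literature/NumberTheory/LFunctions`. THEOREMS (everything proved). A refinement of
`LandauGonek.rightLine_bound` (the right edge `Re s = 2` of Landau's contour in the uniform form
of Gonek 1993 Thm. 1). There the terms `n` with `x/2 < n < 2x` of

  `∫_{−T}^{T} (−ζ'/ζ)(2+it) x^{2+it} dt = ∑_n Λ(n) (x/n)² ∫_{−T}^{T} (x/n)^{it} dt`

were all estimated through `|log(x/n)| ≥ ⟨x⟩/(2x)`, which costs `x² · min(T, x/⟨x⟩)`. Here the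
book-keeping of [Gonek1993, Thm. 1 (proof)] is followed one step further: only the (at most two)
prime powers `n` with `|x − n| < 1` are near-resonant and pay `log(3x)·min(T, x/⟨x⟩)`; every other
`n ∈ (x/2, 2x)` has `|log(x/n)| ≥ 1/(2x)` and pays `≤ 16 x log(3x)`, and there are `< 2x + 2` of them:

* `rightLine_bound_sharp` — there is an absolute `C` with, for `x > 1`, `T > 0`,
  `‖∫_{−T}^{T} (−ζ'/ζ)(2+it) x^{2+it} dt − 2T Λ(x)‖ ≤ C (x² log(3x) + log(3x)·min(T, x/⟨x⟩))`.

The power `x²` (for Gonek's `x log 2x`, which needs the line `Re s = 1 + 1/log 3x` and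
Brun–Titchmarsh) is kept; what matters downstream (bilinear sums of Landau's formula over the
ratios `x = m/m'` of integers `≤ M`) is that the resonance term is no longer multiplied by `x²`.

## References

* S. M. Gonek, *An explicit formula of Landau and its applications to the theory of the
  zeta-function*, Contemp. Math. 143 (1993), 395–413, Thm. 1 (proof). [Gonek1993]
* H. L. Montgomery, R. C. Vaughan, *Multiplicative Number Theory I*, CUP 2007, Cor. 5.3.
  [MontgomeryVaughan2007]
-/

noncomputable section

open Complex Set MeasureTheory Filter Topology intervalIntegral Real
open ArithmeticFunction hiding log id
open scoped Chebyshev Interval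

namespace Literature.NumberTheory.LFunctions

namespace LandauGonek

open PerronPsi

/-- For `x > 1`: `1 < log(3x)` (`e < 3`). [folklore] -/
theorem one_lt_log_three_mul {x : ℝ} (hx : 1 < x) : 1 < Real.log (3 * x) := by
  calc (1 : ℝ) < Real.log 3 := (Real.lt_log_iff_exp_lt (by norm_num)).mpr Real.exp_one_lt_three
    _ ≤ Real.log (3 * x) := Real.log_le_log (by norm_num) (by linarith)

/-- A natural number at distance `< 1` from the real `x ≥ 0` is `⌊x⌋₊` or `⌈x⌉₊`. [folklore] -/
theorem eq_floor_or_ceil_of_abs_sub_lt_one {x : ℝ} (hx : 0 ≤ x) {n : ℕ} (h : |x - n| < 1) :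
    n = ⌊x⌋₊ ∨ n = ⌈x⌉₊ := by
  rw [abs_lt] at h
  rcases le_or_gt (n : ℝ) x with hle | hlt
  · left
    exact ((Nat.floor_eq_iff hx).2 ⟨hle, by linarith⟩).symm
  · right
    have hn0 : n ≠ 0 := by
      rintro rfl
      simp at hlt
      linarith
    have hcast : ((n - 1 : ℕ) : ℝ) = (n : ℝ) - 1 := by
      rw [Nat.cast_sub (Nat.one_le_iff_ne_zero.2 hn0)]; simp
    exact ((Nat.ceil_eq_iff hn0).2 ⟨by rw [hcast]; linarith, hlt.le⟩).symm

set_option maxHeartbeats 800000 in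
/-- **The Dirichlet-series side of Landau's formula, sharp in the resonance term.** There is an
absolute `C > 0` such that for all `x > 1` and `T > 0`,
`‖∫_{−T}^{T} (−ζ'/ζ)(2+it) x^{2+it} dt − 2T Λ(x)‖ ≤ C (x² log(3x) + log(3x) · min(T, x/⟨x⟩))`,
where `Λ(x) = Λ(n)` if `x = n` is an integer and `Λ(x) = 0` otherwise, and `⟨x⟩ = primePowDist x`:
termwise integration of `∑ Λ(n)(x/n)^s` on `Re s = 2`, the term `n = x` giving `2T Λ(x)`, the
others `≤ Λ(n)(x/n)² min(2T, 2/|log(x/n)|)`, with `|log(x/n)| ≥ log 2` off `(x/2, 2x)`,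
`≥ |x − n|/(2x) ≥ 1/(2x)` for `|x − n| ≥ 1`, and `≥ ⟨x⟩/(2x)` for the at most two prime powers
`n ∈ {⌊x⌋, ⌈x⌉}`, `n ≠ x`. [cite: Gonek1993, Thm. 1 (proof)] -/
theorem rightLine_bound_sharp :
    ∃ C : ℝ, 0 < C ∧ ∀ x : ℝ, 1 < x → ∀ T : ℝ, 0 < T →
      ‖(∫ t in (-T)..T, (fun s : ℂ ↦ (-deriv riemannZeta s / riemannZeta s) * (x : ℂ) ^ s)
            (((2 : ℝ) : ℂ) + t * I)) -
          ((2 * T * (if ((⌊x⌋₊ : ℕ) : ℝ) = x then Λ ⌊x⌋₊ else 0) : ℝ) : ℂ)‖ ≤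
        C * (x ^ 2 * Real.log (3 * x) + Real.log (3 * x) * min T (x / primePowDist x)) := by
  obtain ⟨K₀, hK₀0, hK₀⟩ := exists_tsum_vonMangoldt_div_rpow_le'
  obtain ⟨hsum2, htsum2⟩ := hK₀ 2 one_lt_two
  have htsum2' : ∑' n : ℕ, Λ n / (n : ℝ) ^ (2 : ℝ) ≤ 1 + K₀ := htsum2.trans (by norm_num)
  refine ⟨3 * (1 + K₀) + 64, by positivity, fun x hx T hT ↦ ?_⟩
  classical
  have hx0 : 0 < x := by linarith
  set S₂ : ℝ := ∑' n : ℕ, Λ n / (n : ℝ) ^ (2 : ℝ) with hS₂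
  have hS₂0 : 0 ≤ S₂ := tsum_nonneg fun n ↦ div_nonneg vonMangoldt_nonneg (by positivity)
  set m : ℝ := min T (x / primePowDist x) with hm
  have hpd := primePowDist_pos x
  have hm0 : 0 ≤ m := le_min hT.le (by positivity)
  set L : ℝ := Real.log (3 * x) with hL
  have hL1 : 1 < L := one_lt_log_three_mul hx
  have hL0 : 0 < L := by linarith
  have hlog2x : Real.log (2 * x) ≤ L := Real.log_le_log (by positivity) (by linarith)
  -- the two finite sets of near terms
  set N₂ : Finset ℕ := Finset.range (2 * ⌈x⌉₊) with hN₂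
  set N₃ : Finset ℕ := {⌊x⌋₊, ⌈x⌉₊} with hN₃
  have hcard₂ : (N₂.card : ℝ) ≤ 4 * x := by
    rw [hN₂, Finset.card_range]
    push_cast
    have := Nat.ceil_lt_add_one hx0.le
    linarith
  have hcard₃ : (N₃.card : ℝ) ≤ 2 := by
    have : N₃.card ≤ 2 := by rw [hN₃]; exact Finset.card_le_two
    exact_mod_cast this
  -- the termwise data
  set F : ℕ → ℝ → ℂ := fun n t ↦ (Λ n : ℂ) * (((x / n : ℝ)) : ℂ) ^ (((2 : ℝ) : ℂ) + (t : ℂ) * I)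
    with hF
  set f : ℝ → ℂ := fun t ↦ (fun s : ℂ ↦ (-deriv riemannZeta s / riemannZeta s) * (x : ℂ) ^ s)
    (((2 : ℝ) : ℂ) + t * I) with hf
  -- the dominating series `Λ(n) (x/n)² = x² Λ(n)/n²`
  have hbound_eq : ∀ n : ℕ, Λ n * (x / n) ^ 2 = x ^ 2 * (Λ n / (n : ℝ) ^ (2 : ℝ)) := by
    intro n
    rw [Real.rpow_two]
    rcases Nat.eq_zero_or_pos n with rfl | hn
    · simp
    · have : (n : ℝ) ≠ 0 := by exact_mod_cast hn.ne'
      field_simp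
  have hbsum : Summable fun n : ℕ ↦ Λ n * (x / n) ^ 2 :=
    (hsum2.mul_left (x ^ 2)).congr fun n ↦ (hbound_eq n).symm
  have hbhas : HasSum (fun n : ℕ ↦ Λ n * (x / n) ^ 2) (x ^ 2 * S₂) :=
    (hsum2.hasSum.mul_left (x ^ 2)).congr_fun fun n ↦ (hbound_eq n)
  -- (1) termwise integration
  have hDCT : HasSum (fun n ↦ ∫ t in (-T)..T, F n t) (∫ t in (-T)..T, f t) := by
    refine intervalIntegral.hasSum_integral_of_dominated_convergence
      (fun n _ ↦ Λ n * (x / n) ^ 2)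
      (fun n ↦ (continuous_term x n).aestronglyMeasurable)
      (fun n ↦ Eventually.of_forall fun t _ ↦ norm_term_le hx0 n t)
      (Eventually.of_forall fun t _ ↦ hbsum) intervalIntegrable_const
      (Eventually.of_forall fun t _ ↦ ?_)
    have hs : 1 < (((2 : ℝ) : ℂ) + t * I).re := by simp
    exact hasSum_vonMangoldt_mul_cpow hx0 hs
  -- (2) the main term
  set main : ℕ → ℂ := fun n ↦ if (n : ℝ) = x then (((2 * T * Λ n : ℝ)) : ℂ) else 0 with hmain
  have hmain0 : ∀ n : ℕ, n ≠ ⌊x⌋₊ → main n = 0 := by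
    intro n hn
    have h : ¬ ((n : ℝ) = x) := fun h ↦ hn (by rw [← h, Nat.floor_natCast])
    simp only [hmain, if_neg h]
  have hmainsum : HasSum main (((2 * T * (if ((⌊x⌋₊ : ℕ) : ℝ) = x then Λ ⌊x⌋₊ else 0) : ℝ)) : ℂ) := by
    have h := hasSum_single (f := main) ⌊x⌋₊ (fun n hn ↦ hmain0 n hn)
    have hval : main ⌊x⌋₊ = (((2 * T * (if ((⌊x⌋₊ : ℕ) : ℝ) = x then Λ ⌊x⌋₊ else 0) : ℝ)) : ℂ) := by
      simp only [hmain]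
      split_ifs <;> simp
    rwa [hval] at h
  -- (3) the termwise majorant
  set g : ℕ → ℝ := fun n ↦ 3 * (Λ n * (x / n) ^ 2) + (if n ∈ N₂ then 16 * x * L else 0) +
    (if n ∈ N₃ then 16 * L * m else 0) with hg
  have hg₁ : ∀ n, 0 ≤ 3 * (Λ n * (x / n) ^ 2) := fun n ↦
    mul_nonneg (by norm_num) (mul_nonneg vonMangoldt_nonneg (sq_nonneg _))
  have hg₂ : ∀ n, 0 ≤ (if n ∈ N₂ then 16 * x * L else 0) := fun n ↦ by
    split_ifs
    · positivity
    · exact le_rfl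
  have hg₃ : ∀ n, 0 ≤ (if n ∈ N₃ then 16 * L * m else 0) := fun n ↦ by
    split_ifs
    · positivity
    · exact le_rfl
  have hgn0 : ∀ n, 0 ≤ g n := fun n ↦ by
    simp only [hg]
    linarith [hg₁ n, hg₂ n, hg₃ n]
  have hgsum : HasSum g (3 * (x ^ 2 * S₂) + (N₂.card : ℝ) * (16 * x * L) + (N₃.card : ℝ) * (16 * L * m)) := by
    have h2 : HasSum (fun n : ℕ ↦ if n ∈ N₂ then 16 * x * L else 0) ((N₂.card : ℝ) * (16 * x * L)) := by
      have h : HasSum (fun n : ℕ ↦ if n ∈ N₂ then 16 * x * L else 0)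
          (∑ n ∈ N₂, if n ∈ N₂ then 16 * x * L else 0) :=
        hasSum_sum_of_ne_finset_zero (fun n hn ↦ if_neg hn)
      rwa [Finset.sum_congr rfl (fun n hn ↦ if_pos hn), Finset.sum_const, nsmul_eq_mul] at h
    have h3 : HasSum (fun n : ℕ ↦ if n ∈ N₃ then 16 * L * m else 0) ((N₃.card : ℝ) * (16 * L * m)) := by
      have h : HasSum (fun n : ℕ ↦ if n ∈ N₃ then 16 * L * m else 0)
          (∑ n ∈ N₃, if n ∈ N₃ then 16 * L * m else 0) :=
        hasSum_sum_of_ne_finset_zero (fun n hn ↦ if_neg hn)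
      rwa [Finset.sum_congr rfl (fun n hn ↦ if_pos hn), Finset.sum_const, nsmul_eq_mul] at h
    exact ((hbhas.mul_left 3).add h2).add h3
  have hterm : ∀ n : ℕ, ‖(∫ t in (-T)..T, F n t) - main n‖ ≤ g n := by
    intro n
    rcases Nat.eq_zero_or_pos n with rfl | hn
    · -- `n = 0`
      have h0 : main 0 = 0 := hmain0 0 (by
        intro h
        have : 0 < ⌊x⌋₊ := Nat.floor_pos.2 hx.le
        omega)
      rw [h0, sub_zero]
      simpa [hF] using hgn0 0
    have hnpos : (0 : ℝ) < n := by exact_mod_cast hn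
    have hy : 0 < x / n := div_pos hx0 hnpos
    -- the integral of the `n`-th term
    have hint : ∫ t in (-T)..T, F n t =
        (Λ n : ℂ) * ((((x / n) ^ 2 : ℝ)) : ℂ) * ∫ t in (-T)..T, ((x / n : ℝ) : ℂ) ^ ((t : ℂ) * I) := by
      simp only [hF, cpow_two_add hy]
      rw [← intervalIntegral.integral_const_mul]
      refine intervalIntegral.integral_congr fun t _ ↦ ?_
      ring
    by_cases hnx : (n : ℝ) = x
    · -- the main term `n = x`
      have hy1 : x / n = 1 := by rw [hnx, div_self hx0.ne']
      have hmn : main n = (((2 * T * Λ n : ℝ)) : ℂ) := by simp only [hmain, if_pos hnx]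
      rw [hint, hmn, hy1, integral_one_cpow_mul_I]
      have : (Λ n : ℂ) * ((((1 : ℝ) ^ 2 : ℝ)) : ℂ) * (2 * (T : ℂ)) - (((2 * T * Λ n : ℝ)) : ℂ) = 0 := by
        push_cast; ring
      rw [this, norm_zero]
      exact hgn0 n
    · have hmn : main n = 0 := by simp only [hmain, if_neg hnx]
      rw [hmn, sub_zero, hint, norm_mul, norm_mul, norm_real, Real.norm_eq_abs,
        abs_of_nonneg vonMangoldt_nonneg, norm_real, Real.norm_eq_abs, abs_of_nonneg (sq_nonneg _)]
      by_cases hΛ : Λ n = 0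
      · rw [hΛ]; simpa using hgn0 n
      have hpp : IsPrimePow n := vonMangoldt_ne_zero_iff.1 hΛ
      have hy1 : x / n ≠ 1 := fun h ↦ hnx (by rw [div_eq_one_iff_eq hnpos.ne'] at h; exact h.symm)
      have hosc := norm_integral_cpow_mul_I_le hy hy1 hT.le
      have hΛn0 : 0 ≤ Λ n := vonMangoldt_nonneg
      have hxn0 : 0 ≤ (x / n) ^ 2 := sq_nonneg _
      by_cases hnear : x / 2 < n ∧ (n : ℝ) < 2 * x
      · -- near `x`: `(x/n)² ≤ 4`, `Λ(n) ≤ log(2x) ≤ L`, `|log(x/n)| ≥ |x − n|/(2x)`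
        have hlog := abs_sub_div_le_abs_log hx0 hnear.1 hnear.2
        have hxn4 : (x / n) ^ 2 ≤ 4 := by
          have h1 : x / n < 2 := by rw [div_lt_iff₀ hnpos]; linarith [hnear.1]
          nlinarith [hy.le]
        have hΛL : Λ n ≤ L := by
          calc Λ n ≤ Real.log n := vonMangoldt_le_log
            _ ≤ Real.log (2 * x) := Real.log_le_log hnpos hnear.2.le
            _ ≤ L := hlog2x
        have hlogpos : 0 < |Real.log (x / n)| := by
          have : 0 < |x - n| := abs_pos.2 (sub_ne_zero.2 (Ne.symm hnx))
          exact lt_of_lt_of_le (by positivity) hlog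
        by_cases hfar1 : 1 ≤ |x - n|
        · -- `|x − n| ≥ 1`: the oscillatory integral is `≤ 4x`
          have h1 : 2 / |Real.log (x / n)| ≤ 4 * x := by
            rw [div_le_iff₀ hlogpos]
            have h2 : 1 / (2 * x) ≤ |Real.log (x / n)| :=
              le_trans (div_le_div_of_nonneg_right hfar1 (by positivity)) hlog
            have h3 : 1 ≤ 2 * x * |Real.log (x / n)| := by
              rwa [div_le_iff₀ (by positivity), mul_comm] at h2
            nlinarith
          have h4 : min (2 * T) (2 / |Real.log (x / n)|) ≤ 4 * x := (min_le_right _ _).trans h1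
          have hmem : n ∈ N₂ := by
            rw [hN₂, Finset.mem_range]
            have hc : x ≤ ⌈x⌉₊ := Nat.le_ceil x
            have : (n : ℝ) < 2 * (⌈x⌉₊ : ℝ) := by linarith [hnear.2]
            exact_mod_cast this
          have hval : 16 * x * L ≤ g n := by
            simp only [hg, if_pos hmem]
            linarith [hg₁ n, hg₃ n]
          refine le_trans ?_ hval
          have hosc0 : 0 ≤ ‖∫ t in (-T)..T, ((x / n : ℝ) : ℂ) ^ ((t : ℂ) * I)‖ := norm_nonneg _
          calc Λ n * (x / n) ^ 2 * ‖∫ t in (-T)..T, ((x / n : ℝ) : ℂ) ^ ((t : ℂ) * I)‖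
              ≤ L * 4 * (4 * x) := by
                refine mul_le_mul (mul_le_mul hΛL hxn4 hxn0 hL0.le) (hosc.trans h4) hosc0 ?_
                positivity
            _ = 16 * x * L := by ring
        · -- `|x − n| < 1`: `n ∈ {⌊x⌋, ⌈x⌉}` and `|log(x/n)| ≥ ⟨x⟩/(2x)`
          push Not at hfar1
          have hmem : n ∈ N₃ := by
            rw [hN₃, Finset.mem_insert, Finset.mem_singleton]
            exact eq_floor_or_ceil_of_abs_sub_lt_one hx0.le hfar1
          have hdist := primePowDist_le (x := x) hpp hnx
          have h1 : 2 / |Real.log (x / n)| ≤ 4 * (x / primePowDist x) := by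
            rw [div_le_iff₀ hlogpos]
            have h2 : primePowDist x / (2 * x) ≤ |Real.log (x / n)| :=
              le_trans (div_le_div_of_nonneg_right hdist (by positivity)) hlog
            have h3 : primePowDist x ≤ 2 * x * |Real.log (x / n)| := by
              rwa [div_le_iff₀ (by positivity), mul_comm] at h2
            calc (2 : ℝ) = 2 * primePowDist x * (1 / primePowDist x) := by field_simp
              _ ≤ 2 * (2 * x * |Real.log (x / n)|) * (1 / primePowDist x) := by gcongr
              _ = 4 * (x / primePowDist x) * |Real.log (x / n)| := by ring
          have h4 : min (2 * T) (2 / |Real.log (x / n)|) ≤ 4 * m := by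
            rw [hm]
            rcases le_total T (x / primePowDist x) with h | h
            · rw [min_eq_left h]; exact (min_le_left _ _).trans (by linarith)
            · rw [min_eq_right h]; exact (min_le_right _ _).trans h1
          have hval : 16 * L * m ≤ g n := by
            simp only [hg, if_pos hmem]
            linarith [hg₁ n, hg₂ n]
          refine le_trans ?_ hval
          have hosc0 : 0 ≤ ‖∫ t in (-T)..T, ((x / n : ℝ) : ℂ) ^ ((t : ℂ) * I)‖ := norm_nonneg _
          calc Λ n * (x / n) ^ 2 * ‖∫ t in (-T)..T, ((x / n : ℝ) : ℂ) ^ ((t : ℂ) * I)‖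
              ≤ L * 4 * (4 * m) := by
                refine mul_le_mul (mul_le_mul hΛL hxn4 hxn0 hL0.le) (hosc.trans h4) hosc0 ?_
                positivity
            _ = 16 * L * m := by ring
      · -- far from `x`: `|log(x/n)| ≥ log 2`
        have hlog2 : Real.log 2 ≤ |Real.log (x / n)| := by
          rw [not_and_or] at hnear
          rcases hnear with h | h
          · push Not at h
            have h2 : 2 ≤ x / n := by rw [le_div_iff₀ hnpos]; linarith
            calc Real.log 2 ≤ Real.log (x / n) := Real.log_le_log two_pos h2
              _ ≤ |Real.log (x / n)| := le_abs_self _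
          · push Not at h
            have h2 : 2 ≤ n / x := by rw [le_div_iff₀ hx0]; linarith
            calc Real.log 2 ≤ Real.log (n / x) := Real.log_le_log two_pos h2
              _ = -Real.log (x / n) := by rw [← Real.log_inv, inv_div]
              _ ≤ |Real.log (x / n)| := neg_le_abs _
        have hl2 : (2 : ℝ) / 3 < Real.log 2 := by linarith [Real.log_two_gt_d9]
        have h1 : 2 / |Real.log (x / n)| ≤ 3 := by
          rw [div_le_iff₀ (lt_of_lt_of_le (by positivity) hlog2)]
          linarith
        have h4 : min (2 * T) (2 / |Real.log (x / n)|) ≤ 3 := (min_le_right _ _).trans h1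
        have hval : 3 * (Λ n * (x / n) ^ 2) ≤ g n := by
          simp only [hg]
          linarith [hg₂ n, hg₃ n]
        refine le_trans ?_ hval
        have hosc0 : 0 ≤ ‖∫ t in (-T)..T, ((x / n : ℝ) : ℂ) ^ ((t : ℂ) * I)‖ := norm_nonneg _
        calc Λ n * (x / n) ^ 2 * ‖∫ t in (-T)..T, ((x / n : ℝ) : ℂ) ^ ((t : ℂ) * I)‖
            ≤ Λ n * (x / n) ^ 2 * 3 :=
              mul_le_mul_of_nonneg_left (hosc.trans h4) (mul_nonneg hΛn0 hxn0)
          _ = 3 * (Λ n * (x / n) ^ 2) := by ring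
  -- (4) summation
  have hdiff := hDCT.sub hmainsum
  have hle := HasSum.norm_le_of_bounded hdiff hgsum hterm
  refine hle.trans ?_
  have hx2 : x ^ 2 ≤ x ^ 2 * L := le_mul_of_one_le_right (sq_nonneg _) hL1.le
  have h1 : 3 * (x ^ 2 * S₂) ≤ 3 * (1 + K₀) * (x ^ 2 * L) := by
    calc 3 * (x ^ 2 * S₂) ≤ 3 * (x ^ 2 * (1 + K₀)) := by gcongr
      _ = 3 * (1 + K₀) * x ^ 2 := by ring
      _ ≤ 3 * (1 + K₀) * (x ^ 2 * L) := mul_le_mul_of_nonneg_left hx2 (by positivity)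
  have h2 : (N₂.card : ℝ) * (16 * x * L) ≤ 64 * (x ^ 2 * L) := by
    calc (N₂.card : ℝ) * (16 * x * L) ≤ 4 * x * (16 * x * L) :=
          mul_le_mul_of_nonneg_right hcard₂ (by positivity)
      _ = 64 * (x ^ 2 * L) := by ring
  have h3 : (N₃.card : ℝ) * (16 * L * m) ≤ 32 * (L * m) := by
    calc (N₃.card : ℝ) * (16 * L * m) ≤ 2 * (16 * L * m) :=
          mul_le_mul_of_nonneg_right hcard₃ (by positivity)
      _ = 32 * (L * m) := by ring
  have hLm : 0 ≤ L * m := by positivity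
  have hxL : 0 ≤ x ^ 2 * L := by positivity
  nlinarith [h1, h2, h3, hLm, hxL, hK₀0]

end LandauGonek

end Literature.NumberTheory.LFunctions

end
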